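import Literature.MathematicalPhysics.KineticTheory.HardSphereEuler
import Literature.Analysis.FunctionSpaces.TorusSpaceTime
import Literature.Analysis.FunctionSpaces.TorusCalculusProofs

/-!
# Macroscopic bookkeeping for the hydrodynamic-limit assembly — VI: compactness bounds for the classical solution

Helper file for item stmt-AtomisticToContinuum-11094 (`StiffCollisionalRelaxation.Assembly`).
`RelEntropyStability` is applied to the classical hs-Euler solution restricted to a compact time
interval `[0, T′]`, `t < T′ < T`, where its density has a positive floor `c₁` (and its fields are
bounded); the restriction itself is the tree's `isHardSphereEulerSolution_restrict`
(`Theorems/ImplosionDichotomyPolynomialCompressionSolutionAPI.lean`). This file supplies the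
compactness half:

* `exists_pos_le_of_pos` — a space–time field with continuous lift on `S × ℝ³`, positive on
  `K × 𝕋³` for a compact `K ⊆ S`, has a positive lower bound there (minimum over
  `K × [0,1]³`);
* `exists_density_floor`, `exists_temperature_floor`, `exists_fields_bound`, `exists_energy_floor` — for a classical solution on `[0, T)` and `T′ < T`: positive floors for
  `ρ`, `θ` and a common bound for `|ρ|, ‖u‖, |θ|` on `[0, T′] × 𝕋³`.
-/

namespace Summit.AtomisticToContinuum.HydrodynamicLimit.Theorems.MacroBookkeeping

open Set Filter Topology
open Literature.MathematicalPhysics.KineticTheory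
open Literature.Analysis.FunctionSpaces
open Literature.Analysis.FunctionSpaces.Torus

noncomputable section

/-- **Positive floor on compact time sets.** A real space–time field with continuous lift on
`S × ℝ³` which is positive on `K × 𝕋³`, `K ⊆ S` compact, is bounded below there by a positive
constant. -/
theorem exists_pos_le_of_pos {S K : Set ℝ} {w : ℝ → T3 → ℝ}
    (hw : ContinuousOn (stLift w) (S ×ˢ univ)) (hK : IsCompact K) (hKS : K ⊆ S)
    (hpos : ∀ t ∈ K, ∀ x, 0 < w t x) : ∃ c : ℝ, 0 < c ∧ ∀ t ∈ K, ∀ x, c ≤ w t x := by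
  by_cases hKe : K = ∅
  · exact ⟨1, one_pos, fun t ht => by simp [hKe] at ht⟩
  obtain ⟨t₀, ht₀⟩ := nonempty_iff_ne_empty.2 hKe
  set C : Set (ℝ × EuclideanSpace ℝ (Fin 3)) :=
    K ×ˢ ((WithLp.toLp 2) '' (Set.pi univ fun _ : Fin 3 => Icc (0 : ℝ) 1)) with hC
  have hCc : IsCompact C := hK.prod isCompact_toLp_image_pi_Icc
  have hCne : C.Nonempty := ⟨(t₀, repr (0 : T3)), mk_mem_prod ht₀ (repr_mem_toLp_image_pi_Icc _)⟩
  have hcont : ContinuousOn (stLift w) C := hw.mono (prod_mono hKS (subset_univ _))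
  obtain ⟨p, hpC, hpmin⟩ := hCc.exists_isMinOn hCne hcont
  refine ⟨stLift w p, ?_, fun t ht x => ?_⟩
  · rw [stLift_apply]
    exact hpos p.1 (mem_prod.1 hpC).1 _
  · have h := hpmin (mk_mem_prod ht (repr_mem_toLp_image_pi_Icc x) : (t, repr x) ∈ C)
    simpa using h

/-- **Density floor** of a classical hs-Euler solution on a compact sub-interval `[0, T′]`,
`T′ < T`. -/
theorem exists_density_floor {σ T T' : ℝ} {ρ θ : ℝ → T3 → ℝ}
    {u : ℝ → T3 → V3} (h : IsHardSphereEulerSolution σ T ρ u θ) (hT' : T' < T) :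
    ∃ c : ℝ, 0 < c ∧ ∀ t ∈ Icc 0 T', ∀ x, c ≤ ρ t x :=
  exists_pos_le_of_pos h.smooth_density.continuousOn_stLift isCompact_Icc
    (Icc_subset_Ico_right hT') fun t ht x => h.density_pos t (Icc_subset_Ico_right hT' ht) x

/-- **Temperature floor** of a classical hs-Euler solution on `[0, T′]`, `T′ < T`. -/
theorem exists_temperature_floor {σ T T' : ℝ} {ρ θ : ℝ → T3 → ℝ}
    {u : ℝ → T3 → V3} (h : IsHardSphereEulerSolution σ T ρ u θ) (hT' : T' < T) :
    ∃ c : ℝ, 0 < c ∧ ∀ t ∈ Icc 0 T', ∀ x, c ≤ θ t x :=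
  exists_pos_le_of_pos h.smooth_temperature.continuousOn_stLift isCompact_Icc
    (Icc_subset_Ico_right hT') fun t ht x => h.temperature_pos t (Icc_subset_Ico_right hT' ht) x

/-- **Uniform bounds** for the fields of a classical hs-Euler solution on `[0, T′]`, `T′ < T`. -/
theorem exists_fields_bound {σ T T' : ℝ} {ρ θ : ℝ → T3 → ℝ}
    {u : ℝ → T3 → V3} (h : IsHardSphereEulerSolution σ T ρ u θ) (hT' : T' < T) :
    ∃ B : ℝ, ∀ t ∈ Icc 0 T', ∀ x, |ρ t x| ≤ B ∧ ‖u t x‖ ≤ B ∧ |θ t x| ≤ B := by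
  have hsub : Icc (0 : ℝ) T' ⊆ Ico 0 T := Icc_subset_Ico_right hT'
  obtain ⟨B₁, hB₁⟩ := h.smooth_density.exists_norm_le_of_isCompact isCompact_Icc hsub
  obtain ⟨B₂, hB₂⟩ := h.smooth_velocity.exists_norm_le_of_isCompact isCompact_Icc hsub
  obtain ⟨B₃, hB₃⟩ := h.smooth_temperature.exists_norm_le_of_isCompact isCompact_Icc hsub
  refine ⟨max B₁ (max B₂ B₃), fun t ht x => ⟨?_, ?_, ?_⟩⟩
  · exact (Real.norm_eq_abs _ ▸ hB₁ t ht x).trans (le_max_left _ _)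
  · exact (hB₂ t ht x).trans ((le_max_left _ _).trans (le_max_right _ _))
  · exact (Real.norm_eq_abs _ ▸ hB₃ t ht x).trans ((le_max_right _ _).trans (le_max_right _ _))

/-- The classical total energy density is bounded below by a positive constant on `[0, T′] × 𝕋³`
(`E = ρ(|u|²/2 + 3θ/2) ≥ (3/2) c_ρ c_θ`). -/
theorem exists_energy_floor {σ T T' : ℝ} {ρ θ : ℝ → T3 → ℝ}
    {u : ℝ → T3 → V3} (h : IsHardSphereEulerSolution σ T ρ u θ) (hT' : T' < T) :
    ∃ c : ℝ, 0 < c ∧ ∀ t ∈ Icc 0 T', ∀ x, c ≤ totalEnergyDensity (ρ t x) (u t x) (θ t x) := by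
  obtain ⟨cρ, hcρ, hρ⟩ := exists_density_floor h hT'
  obtain ⟨cθ, hcθ, hθ⟩ := exists_temperature_floor h hT'
  refine ⟨3 / 2 * cρ * cθ, by positivity, fun t ht x => ?_⟩
  have h1 := hρ t ht x
  have h2 := hθ t ht x
  unfold totalEnergyDensity
  have h3 : 3 / 2 * cθ ≤ ‖u t x‖ ^ 2 / 2 + 3 / 2 * θ t x := by nlinarith [sq_nonneg ‖u t x‖]
  calc 3 / 2 * cρ * cθ = cρ * (3 / 2 * cθ) := by ring
    _ ≤ ρ t x * (‖u t x‖ ^ 2 / 2 + 3 / 2 * θ t x) :=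
        mul_le_mul h1 h3 (by positivity) (hcρ.le.trans h1)

end

end Summit.AtomisticToContinuum.HydrodynamicLimit.Theorems.MacroBookkeeping
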